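import Summits.Ventures.Crystal3D.Theorems.StickyWulffConstantGenericWallFloorCapRigidity
import HarnessLib

/-!
# Mixed kissing patterns around an fcc ball: the core inequalities in cubic coordinates

HONEST FRAMING. Part of the venture `Summits/Ventures/Crystal3D` (cell `crystal3d-full`), helper for the
crux `GenericWallFloor` (stmt-Ventures-19480) of `route-Ventures-StickyWulffConstant`, line `WallLedgerG`:
the NON-SATURATION input of the rigid-bicrystal rung of `stub_twoSlabAdhesion` (module M5 of the note
RIGID-RUNG-ARCH on the item, there a certified computation; here the start of a kernel proof).
Elementary real algebra; rung credit only.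

Setting.  In the cubic frame of `…SlotGeometry` (`⟪p, q⟫ = ½ (A p A q + B p B q + C p C q)`) a unit
vector `d` has coordinates `D = (x, y, z)` with `x² + y² + z² = 2`, the twelve slots are the
permutations of `(±1, ±1, 0)`, and `⟪w, d⟫ ≤ ½` (the ball at the slot `w` does not overlap a foreign
ball in direction `d`) reads `w · D ≤ 1`, while `⟪w, d⟫ > ½` (the foreign ball blocks the slot) reads
`w · D > 1`.  This file proves, in ONE normalised frame (square `{x = 1}` with vertices
`(1,±1,0), (1,0,±1)`, face `{(1,1,0), (1,0,1), (0,1,1)}`), the inequalities behind the case analysis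
"a lattice ball with at most three foreign contacts is unsaturated unless the contacts form the twin
triple over a face":

* `cubic_square_core` — blocked `(1,0,1)`, unblocked `(1,0,−1)`, `(0,±1,1)` ⇒ `x ≥ 1`, `z > 0`,
  `|y| + z ≤ 1` (the direction lies within `45°` of the square's axis);
* `cubic_pair_sign` — two such directions at `≥ 60°` have `y y' < 0`; `cubic_three_false` — three
  cannot be pairwise `≥ 60°` apart (the `90°`-path and edge-plus-isolated patterns);
* `cubic_edge_false` — if moreover both block `(1,1,0)` and neither blocks `(1,−1,0)`, two cannot be
  `≥ 60°` apart (the two-vacancy and `120°`-path patterns);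
* `cubic_face_sum_ge_two`, `cubic_face_triple`, `cubic_face_vertex` — over the face: the hexagon and
  lower-triple constraints give `x + y + z ≥ 2`, three pairwise-separated such directions all have
  `x + y + z = 2` and mutual products exactly `1`, and then each is a face vertex or a twin position
  `(1,1,4)/3, (1,4,1)/3, (4,1,1)/3` (cap rigidity, `hexagon_quadratic_le/_eq`).

WHAT THIS IS NOT: the combinatorial reduction to the normalised frame and the lattice statement are the
next files; rung F-C1 not moved.
-/

noncomputable section

namespace Summit.Ventures.Crystal3D.Theorems

/-! ## The square: one blocked vertex, its opposite and the two off-square neighbours unblocked -/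

/-- **Square core.**  `x² + y² + z² = 2`, `x + z > 1`, `x − z ≤ 1`, `y + z ≤ 1`, `−y + z ≤ 1` imply
`x ≥ 1`, `z > 0` and `|y| + z ≤ 1`. -/
theorem cubic_square_core (x y z : ℝ) (hn : x ^ 2 + y ^ 2 + z ^ 2 = 2) (h1 : 1 < x + z)
    (h2 : x - z ≤ 1) (h3 : y + z ≤ 1) (h4 : -y + z ≤ 1) : 1 ≤ x ∧ 0 < z ∧ |y| + z ≤ 1 := by
  have hz : 0 < z := by linarith
  have hyz : |y| + z ≤ 1 := by
    rcases le_total 0 y with hy | hy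
    · rw [abs_of_nonneg hy]; exact h3
    · rw [abs_of_nonpos hy]; linarith
  refine ⟨?_, hz, hyz⟩
  have hy2 : y ^ 2 ≤ (1 - z) ^ 2 := by
    have h1z : |y| ≤ 1 - z := by linarith
    have h0 : 0 ≤ 1 - z := le_trans (abs_nonneg y) h1z
    calc y ^ 2 = |y| ^ 2 := (sq_abs y).symm
      _ ≤ (1 - z) ^ 2 := pow_le_pow_left₀ (abs_nonneg y) h1z 2
  have hx2 : 1 ≤ x ^ 2 := by nlinarith
  have hx0 : 0 < x := by linarith
  nlinarith

/-- **Pair sign.**  Two directions as in `cubic_square_core` at mutual product `≤ 1` (angle `≥ 60°`) have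
`y y' < 0`. -/
theorem cubic_pair_sign (x y z x' y' z' : ℝ) (hn : x ^ 2 + y ^ 2 + z ^ 2 = 2)
    (h1 : 1 < x + z) (h2 : x - z ≤ 1) (h3 : y + z ≤ 1) (h4 : -y + z ≤ 1)
    (hn' : x' ^ 2 + y' ^ 2 + z' ^ 2 = 2) (h1' : 1 < x' + z') (h2' : x' - z' ≤ 1) (h3' : y' + z' ≤ 1)
    (h4' : -y' + z' ≤ 1) (hsep : x * x' + y * y' + z * z' ≤ 1) : y * y' < 0 := by
  obtain ⟨hx, hz, -⟩ := cubic_square_core x y z hn h1 h2 h3 h4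
  obtain ⟨hx', hz', -⟩ := cubic_square_core x' y' z' hn' h1' h2' h3' h4'
  have hxx : 1 ≤ x * x' := by nlinarith
  have hzz : 0 < z * z' := mul_pos hz hz'
  linarith

/-- **Three are impossible.**  Three directions as in `cubic_square_core`, pairwise at product `≤ 1`, do
not exist (the signs of `y₁, y₂, y₃` would be pairwise opposite). -/
theorem cubic_three_false (x₁ y₁ z₁ x₂ y₂ z₂ x₃ y₃ z₃ : ℝ)
    (hn₁ : x₁ ^ 2 + y₁ ^ 2 + z₁ ^ 2 = 2) (ha₁ : 1 < x₁ + z₁) (hb₁ : x₁ - z₁ ≤ 1) (hc₁ : y₁ + z₁ ≤ 1)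
    (hd₁ : -y₁ + z₁ ≤ 1)
    (hn₂ : x₂ ^ 2 + y₂ ^ 2 + z₂ ^ 2 = 2) (ha₂ : 1 < x₂ + z₂) (hb₂ : x₂ - z₂ ≤ 1) (hc₂ : y₂ + z₂ ≤ 1)
    (hd₂ : -y₂ + z₂ ≤ 1)
    (hn₃ : x₃ ^ 2 + y₃ ^ 2 + z₃ ^ 2 = 2) (ha₃ : 1 < x₃ + z₃) (hb₃ : x₃ - z₃ ≤ 1) (hc₃ : y₃ + z₃ ≤ 1)
    (hd₃ : -y₃ + z₃ ≤ 1)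
    (h12 : x₁ * x₂ + y₁ * y₂ + z₁ * z₂ ≤ 1) (h13 : x₁ * x₃ + y₁ * y₃ + z₁ * z₃ ≤ 1)
    (h23 : x₂ * x₃ + y₂ * y₃ + z₂ * z₃ ≤ 1) : False := by
  have s12 := cubic_pair_sign x₁ y₁ z₁ x₂ y₂ z₂ hn₁ ha₁ hb₁ hc₁ hd₁ hn₂ ha₂ hb₂ hc₂ hd₂ h12
  have s13 := cubic_pair_sign x₁ y₁ z₁ x₃ y₃ z₃ hn₁ ha₁ hb₁ hc₁ hd₁ hn₃ ha₃ hb₃ hc₃ hd₃ h13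
  have s23 := cubic_pair_sign x₂ y₂ z₂ x₃ y₃ z₃ hn₂ ha₂ hb₂ hc₂ hd₂ hn₃ ha₃ hb₃ hc₃ hd₃ h23
  have h0 : 0 ≤ (y₁ * y₂) * (y₁ * y₃) * (y₂ * y₃) := by
    have e : (y₁ * y₂) * (y₁ * y₃) * (y₂ * y₃) = (y₁ * y₂ * y₃) ^ 2 := by ring
    rw [e]; exact sq_nonneg _
  have hpos : 0 < (y₁ * y₂) * (y₁ * y₃) := mul_pos_of_neg_of_neg s12 s13
  have hneg : (y₁ * y₂) * (y₁ * y₃) * (y₂ * y₃) < 0 := mul_neg_of_pos_of_neg hpos s23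
  linarith

/-- **Edge.**  Two directions as in `cubic_square_core` which moreover both block the adjacent vertex
`(1,1,0)` (`x + y > 1`) and do not block `(1,−1,0)` (`x − y ≤ 1`) cannot be at product `≤ 1`. -/
theorem cubic_edge_false (x y z x' y' z' : ℝ) (hn : x ^ 2 + y ^ 2 + z ^ 2 = 2)
    (h1 : 1 < x + z) (h2 : x - z ≤ 1) (h3 : y + z ≤ 1) (h4 : -y + z ≤ 1) (h5 : 1 < x + y)
    (h6 : x - y ≤ 1)
    (hn' : x' ^ 2 + y' ^ 2 + z' ^ 2 = 2) (h1' : 1 < x' + z') (h2' : x' - z' ≤ 1) (h3' : y' + z' ≤ 1)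
    (h4' : -y' + z' ≤ 1) (h5' : 1 < x' + y') (h6' : x' - y' ≤ 1)
    (hsep : x * x' + y * y' + z * z' ≤ 1) : False := by
  have hs := cubic_pair_sign x y z x' y' z' hn h1 h2 h3 h4 hn' h1' h2' h3' h4' hsep
  obtain ⟨hx, -, -⟩ := cubic_square_core x y z hn h1 h2 h3 h4
  obtain ⟨hx', -, -⟩ := cubic_square_core x' y' z' hn' h1' h2' h3' h4'
  rcases lt_or_ge y 0 with hy | hy
  · linarith
  · have hy' : y' < 0 := by
      by_contra hcon
      push Not at hcon
      have := mul_nonneg hy hcon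
      linarith
    linarith

/-! ## The face `{(1,1,0), (1,0,1), (0,1,1)}`: cap rigidity -/

/-- **Height over the face.**  A direction unblocked by the hexagon `(±1,∓1,0), (±1,0,∓1), (0,±1,∓1)`
(`|x − y|, |x − z|, |y − z| ≤ 1`) and by the lower triple `(−1,−1,0), (−1,0,−1), (0,−1,−1)`
(`x + y, x + z, y + z ≥ −1`) has `x + y + z ≥ 2`. -/
theorem cubic_face_sum_ge_two (x y z : ℝ) (hn : x ^ 2 + y ^ 2 + z ^ 2 = 2)
    (hxy : x - y ≤ 1) (hyx : y - x ≤ 1) (hxz : x - z ≤ 1) (hzx : z - x ≤ 1) (hyz : y - z ≤ 1)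
    (hzy : z - y ≤ 1) (hl₁ : -1 ≤ x + y) (hl₂ : -1 ≤ x + z) (hl₃ : -1 ≤ y + z) : 2 ≤ x + y + z := by
  -- the in-plane part: `(x−y)² + (y−z)² + (x−z)² ≤ 2` by the hexagon lemma
  have hq := hexagon_quadratic_le ((x - y) / 2) ((y - z) / 2)
    (by rw [abs_le]; constructor <;> linarith) (by rw [abs_le]; constructor <;> linarith)
    (by rw [abs_le]; constructor <;> linarith)
  have e1 : (x - y) ^ 2 + (y - z) ^ 2 + (x - z) ^ 2 =
      8 * (((x - y) / 2) ^ 2 + (x - y) / 2 * ((y - z) / 2) + ((y - z) / 2) ^ 2) := by ring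
  have e2 : (x + y + z) ^ 2 = 3 * (x ^ 2 + y ^ 2 + z ^ 2) - ((x - y) ^ 2 + (y - z) ^ 2 + (x - z) ^ 2) := by
    ring
  have hS2 : 4 ≤ (x + y + z) ^ 2 := by rw [e2, hn, e1]; linarith
  have hSlow : 0 < x + y + z + 2 := by linarith
  by_contra hlt
  push Not at hlt
  have : 0 < (2 - (x + y + z)) * (x + y + z + 2) := mul_pos (by linarith) hSlow
  nlinarith

/-- The height is at most `√6 < 3`: `x + y + z ≤ √6`, in the weak form `(x + y + z)² ≤ 6`. -/
theorem cubic_sum_sq_le_six (x y z : ℝ) (hn : x ^ 2 + y ^ 2 + z ^ 2 = 2) : (x + y + z) ^ 2 ≤ 6 := by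
  nlinarith [sq_nonneg (x - y), sq_nonneg (y - z), sq_nonneg (x - z)]

/-- **Three separated directions over the face are extremal.**  If three directions each satisfy the
hypotheses of `cubic_face_sum_ge_two` (so `sᵢ = xᵢ + yᵢ + zᵢ ≥ 2`) and are pairwise at product `≤ 1`,
then all three sums equal `2` and all three mutual products equal `1`. -/
theorem cubic_face_triple (x₁ y₁ z₁ x₂ y₂ z₂ x₃ y₃ z₃ : ℝ)
    (hn₁ : x₁ ^ 2 + y₁ ^ 2 + z₁ ^ 2 = 2) (hn₂ : x₂ ^ 2 + y₂ ^ 2 + z₂ ^ 2 = 2)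
    (hn₃ : x₃ ^ 2 + y₃ ^ 2 + z₃ ^ 2 = 2)
    (hs₁ : 2 ≤ x₁ + y₁ + z₁) (hs₂ : 2 ≤ x₂ + y₂ + z₂) (hs₃ : 2 ≤ x₃ + y₃ + z₃)
    (h12 : x₁ * x₂ + y₁ * y₂ + z₁ * z₂ ≤ 1) (h13 : x₁ * x₃ + y₁ * y₃ + z₁ * z₃ ≤ 1)
    (h23 : x₂ * x₃ + y₂ * y₃ + z₂ * z₃ ≤ 1) :
    x₁ + y₁ + z₁ = 2 ∧ x₂ + y₂ + z₂ = 2 ∧ x₃ + y₃ + z₃ = 2 ∧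
      x₁ * x₂ + y₁ * y₂ + z₁ * z₂ = 1 ∧ x₁ * x₃ + y₁ * y₃ + z₁ * z₃ = 1 ∧
      x₂ * x₃ + y₂ * y₃ + z₂ * z₃ = 1 := by
  -- `(Σ sᵢ)² ≤ 3 ‖Σ Dᵢ‖² = 3 (6 + 2 Σ_{i<j} Dᵢ·Dⱼ) ≤ 36`
  have hnorm : (x₁ + x₂ + x₃) ^ 2 + (y₁ + y₂ + y₃) ^ 2 + (z₁ + z₂ + z₃) ^ 2 =
      (x₁ ^ 2 + y₁ ^ 2 + z₁ ^ 2) + (x₂ ^ 2 + y₂ ^ 2 + z₂ ^ 2) + (x₃ ^ 2 + y₃ ^ 2 + z₃ ^ 2) +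
      2 * ((x₁ * x₂ + y₁ * y₂ + z₁ * z₂) + (x₁ * x₃ + y₁ * y₃ + z₁ * z₃) +
        (x₂ * x₃ + y₂ * y₃ + z₂ * z₃)) := by ring
  have hCS : ((x₁ + x₂ + x₃) + (y₁ + y₂ + y₃) + (z₁ + z₂ + z₃)) ^ 2 ≤
      3 * ((x₁ + x₂ + x₃) ^ 2 + (y₁ + y₂ + y₃) ^ 2 + (z₁ + z₂ + z₃) ^ 2) := by
    have e : 3 * ((x₁ + x₂ + x₃) ^ 2 + (y₁ + y₂ + y₃) ^ 2 + (z₁ + z₂ + z₃) ^ 2) -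
        ((x₁ + x₂ + x₃) + (y₁ + y₂ + y₃) + (z₁ + z₂ + z₃)) ^ 2 =
        ((x₁ + x₂ + x₃) - (y₁ + y₂ + y₃)) ^ 2 + ((y₁ + y₂ + y₃) - (z₁ + z₂ + z₃)) ^ 2 +
        ((x₁ + x₂ + x₃) - (z₁ + z₂ + z₃)) ^ 2 := by ring
    nlinarith [sq_nonneg ((x₁ + x₂ + x₃) - (y₁ + y₂ + y₃)),
      sq_nonneg ((y₁ + y₂ + y₃) - (z₁ + z₂ + z₃)), sq_nonneg ((x₁ + x₂ + x₃) - (z₁ + z₂ + z₃))]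
  have h6 : 6 ≤ (x₁ + x₂ + x₃) + (y₁ + y₂ + y₃) + (z₁ + z₂ + z₃) := by linarith
  have h36 : 36 ≤ ((x₁ + x₂ + x₃) + (y₁ + y₂ + y₃) + (z₁ + z₂ + z₃)) ^ 2 := by
    have h0 : (0 : ℝ) ≤ 6 := by norm_num
    have := pow_le_pow_left₀ h0 h6 2
    linarith
  have hdots : 3 ≤ (x₁ * x₂ + y₁ * y₂ + z₁ * z₂) + (x₁ * x₃ + y₁ * y₃ + z₁ * z₃) +
      (x₂ * x₃ + y₂ * y₃ + z₂ * z₃) := by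
    rw [hnorm, hn₁, hn₂, hn₃] at hCS
    linarith
  have hd12 : x₁ * x₂ + y₁ * y₂ + z₁ * z₂ = 1 := by linarith
  have hd13 : x₁ * x₃ + y₁ * y₃ + z₁ * z₃ = 1 := by linarith
  have hd23 : x₂ * x₃ + y₂ * y₃ + z₂ * z₃ = 1 := by linarith
  -- the sums: `(Σ S)² ≤ 3 ‖Σ D‖² = 36`, so `Σ S ≤ 6`, hence each `Sᵢ = 2`
  have hle : ((x₁ + x₂ + x₃) + (y₁ + y₂ + y₃) + (z₁ + z₂ + z₃)) ^ 2 ≤ 36 := by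
    rw [hnorm, hn₁, hn₂, hn₃, hd12, hd13, hd23] at hCS
    linarith
  have hle6 : (x₁ + x₂ + x₃) + (y₁ + y₂ + y₃) + (z₁ + z₂ + z₃) ≤ 6 := by
    by_contra hgt
    push Not at hgt
    have h0 : (0 : ℝ) ≤ 6 := by norm_num
    have := pow_lt_pow_left₀ hgt h0 two_ne_zero
    linarith
  refine ⟨by linarith, by linarith, by linarith, hd12, hd13, hd23⟩

/-- **Equality case: the six extremal directions over the face.**  A direction unblocked by the
hexagon with `x + y + z = 2` is one of the face vertices `(1,1,0), (1,0,1), (0,1,1)` or one of the twin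
positions `(1,1,4)/3, (1,4,1)/3, (4,1,1)/3`. -/
theorem cubic_face_vertex (x y z : ℝ) (hn : x ^ 2 + y ^ 2 + z ^ 2 = 2)
    (hxy : x - y ≤ 1) (hyx : y - x ≤ 1) (hxz : x - z ≤ 1) (hzx : z - x ≤ 1) (hyz : y - z ≤ 1)
    (hzy : z - y ≤ 1) (hS : x + y + z = 2) :
    (x = 1 ∧ y = 1 ∧ z = 0) ∨ (x = 1 ∧ y = 0 ∧ z = 1) ∨ (x = 0 ∧ y = 1 ∧ z = 1) ∨
      (x = 1 / 3 ∧ y = 1 / 3 ∧ z = 4 / 3) ∨ (x = 1 / 3 ∧ y = 4 / 3 ∧ z = 1 / 3) ∨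
      (x = 4 / 3 ∧ y = 1 / 3 ∧ z = 1 / 3) := by
  have hpa : |(x - y) / 2| ≤ 1 / 2 := by rw [abs_le]; constructor <;> linarith
  have hqa : |(y - z) / 2| ≤ 1 / 2 := by rw [abs_le]; constructor <;> linarith
  have hpqa : |(x - y) / 2 + (y - z) / 2| ≤ 1 / 2 := by rw [abs_le]; constructor <;> linarith
  have e1 : (x - y) ^ 2 + (y - z) ^ 2 + (x - z) ^ 2 =
      8 * (((x - y) / 2) ^ 2 + (x - y) / 2 * ((y - z) / 2) + ((y - z) / 2) ^ 2) := by ring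
  have e2 : (x + y + z) ^ 2 = 3 * (x ^ 2 + y ^ 2 + z ^ 2) - ((x - y) ^ 2 + (y - z) ^ 2 + (x - z) ^ 2) := by
    ring
  have heq : ((x - y) / 2) ^ 2 + (x - y) / 2 * ((y - z) / 2) + ((y - z) / 2) ^ 2 = 1 / 4 := by
    rw [hS, hn, e1] at e2; linarith
  have hcase := hexagon_quadratic_eq ((x - y) / 2) ((y - z) / 2) hpa hqa hpqa heq
  have hr : (x - y) / 2 + (y - z) / 2 = (x - z) / 2 := by ring
  rw [hr] at hcase
  rcases hcase with h0 | h1 | h1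
  · -- `x = z`: then `(x − y)² = 1`
    have hxz' : z = x := by linarith
    rw [hxz'] at heq hn hS
    have hsq : (x - y - 1) * (x - y + 1) = 0 := by linear_combination 4 * heq
    rcases mul_eq_zero.1 hsq with h | h
    · -- `x − y = 1`: `(1,0,1)`
      right; left
      refine ⟨by linarith, by linarith, by linarith⟩
    · -- `x − y = −1`: `(1/3, 4/3, 1/3)`
      right; right; right; right; left
      refine ⟨by linarith, by linarith, by linarith⟩
  · -- `x − z = 1`: then `(x − y)(x − y − 1) = 0`
    have hxz' : z = x - 1 := by linarith
    rw [hxz'] at heq hn hS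
    have hsq : (x - y) * (x - y - 1) = 0 := by linear_combination 4 * heq
    rcases mul_eq_zero.1 hsq with h | h
    · -- `x = y`: `(1,1,0)`
      left
      refine ⟨by linarith, by linarith, by linarith⟩
    · -- `x − y = 1`: `(4/3, 1/3, 1/3)`
      right; right; right; right; right
      refine ⟨by linarith, by linarith, by linarith⟩
  · -- `x − z = −1`: then `(x − y)(x − y + 1) = 0`
    have hxz' : z = x + 1 := by linarith
    rw [hxz'] at heq hn hS
    have hsq : (x - y) * (x - y + 1) = 0 := by linear_combination 4 * heq
    rcases mul_eq_zero.1 hsq with h | h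
    · -- `x = y`: `(1/3, 1/3, 4/3)`
      right; right; right; left
      refine ⟨by linarith, by linarith, by linarith⟩
    · -- `x − y = −1`: `(0,1,1)`
      right; right; left
      refine ⟨by linarith, by linarith, by linarith⟩

end Summit.Ventures.Crystal3D.Theorems

end
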